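import Mathlib
import Literature.AlgebraicGeometry.Resolution.RegularLocalRingsProofs
import Literature.AlgebraicGeometry.Resolution.RegularLocalRingsQuotient
import Literature.AlgebraicGeometry.Resolution.RegularLocalRingsUFD
import Summits.ResolutionOfSingularities.ResolutionOfSingularities.Theorems.WeightedInvariantContactCentreFiltration
import Summits.ResolutionOfSingularities.ResolutionOfSingularities.Theorems.WeightedInvariantIotaOrderEssSmooth
import Summits.ResolutionOfSingularities.ResolutionOfSingularities.Theorems.WeightedInvariantEssSmoothLocalHomOrder
import HarnessLib

/-!
# Monomial type ascends and DESCENDS along essentially smooth local homomorphisms ((o24-C) core)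

Topic: `Summits/ResolutionOfSingularities/ResolutionOfSingularities/Theorems`. Helper for the door item
`HypersurfaceCentreConstruction` (statement `stmt-ResolutionOfSingularities-19897`, route `WeightedInvariant`),
line `local-engine` of `res-L1-w43-plan-1` (L W4.3), ORDER (o24) rung P2, piece **(o24-C)** «(c11)↾≤2
`IotaJEssSmoothCompatibleLE2 iotaOrd jContact`» (hand res-type-078).  The centre filtration `jContact`
(`…ContactCentreFiltration`, p514802) BRANCHES on the predicate `IsMonomialType f` («`f = v · g^ν`, `v` a unit,
`g ∈ 𝔪 ∖ 𝔪²`»); for `jContact` to extend along a local, formally smooth, essentially-of-finite-type homomorphism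
`φ : S → S'` of regular local rings the predicate must be preserved AND reflected by `φ`.  Preservation (§2) is the
reflection of `𝔪`-powers (`…EssSmoothLocalHomOrder`, p507256).  Reflection (§4, equal dimension two, `𝔪 S' = 𝔪'`) is
the substance of this file: if `φ f = v' g'^ν` then a prime factor `p` of `f` inside `q = (g') ∩ S` extends to a power
`g'^b` of `g'` up to a unit, and `b = 1` — because the LOCALISED map `S_q → S'_{(g')}` is again local, formally smooth
and essentially of finite type (§3), so it reflects `𝔪`-powers, while `q = (p)` (height one) makes `p ∉ q^{(2)}`;
then `p` is a regular parameter of `S` with `(φ p) = (g')`, and `f`, `p^ν` divide each other after `φ`, hence before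
(faithful flatness, §1).  No excellence hypothesis on `S` is needed (the statement is false for the completion map of
a non-excellent surface germ, which is not essentially of finite type).

[OURS · L1 W4.3] Replaces the role of NO printed item; NOT a statement of the manuscript
[claim: Hironaka2017, status: under-review]. AI work, weaker than expert review.

## References

* H. Matsumura, *Commutative Ring Theory*, Thm. 23.7/23.9 (flat local homomorphisms with regular fibres), Thm. 20.3
  (regular local rings are factorial). [Matsumura1987]
* A. Grothendieck, EGA IV 17.5.8 (localisations of smooth algebras). [Grothendieck1967]
-/

noncomputable section

open IsLocalRing

set_option linter.dupNamespace false -- mandated namespace of this single-conjunct summit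

namespace Summit.ResolutionOfSingularities.ResolutionOfSingularities.Theorems

namespace EssSmoothDescent

open Summit.ResolutionOfSingularities.ResolutionOfSingularities.Cruxes.HypersurfaceCentreConstruction.LocalEngine
open Summit.ResolutionOfSingularities.ResolutionOfSingularities.Cruxes.HypersurfaceCentreConstruction.LocalEngine.IotaOrderEssSmooth
  (mem_maximalIdeal_pow_iff_of_formallySmooth)
open Literature.AlgebraicGeometry.Resolution

variable {S S' : Type} [CommRing S] [CommRing S'] [IsRegularLocalRing S] [IsRegularLocalRing S'] [Algebra S S']
  [IsLocalHom (algebraMap S S')] [Algebra.FormallySmooth S S'] [Algebra.EssFiniteType S S']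

/-! ## §1. Faithful flatness: ideals and divisibility are reflected -/

variable (S S') in
/-- A local, formally smooth, essentially-of-finite-type homomorphism of regular local rings is faithfully flat.
[cite: Matsumura1987, Thm. 7.2 and §22] -/
theorem faithfullyFlat : Module.FaithfullyFlat S S' := by
  haveI : Module.Flat S S' := IotaOrderEssSmooth.flat_of_formallySmooth_of_essFiniteType S S'
  exact Module.FaithfullyFlat.of_flat_of_isLocalHom

/-- `I S' ∩ S = I` (faithful flatness). [cite: Matsumura1987, Thm. 7.5] -/
theorem comap_map_eq (I : Ideal S) : (I.map (algebraMap S S')).comap (algebraMap S S') = I := by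
  haveI := faithfullyFlat S S'
  exact Ideal.comap_map_eq_self_of_faithfullyFlat I

/-- Membership in an extended ideal is reflected. [cite: Matsumura1987, Thm. 7.5] -/
theorem mem_of_algebraMap_mem_map {I : Ideal S} {x : S} (hx : algebraMap S S' x ∈ I.map (algebraMap S S')) :
    x ∈ I := by
  rw [← comap_map_eq (S' := S') I]
  exact Ideal.mem_comap.mpr hx

/-- The structure map is injective. [folklore] -/
theorem algebraMap_injective : Function.Injective (algebraMap S S') := by
  refine (injective_iff_map_eq_zero _).mpr fun x hx => ?_
  have : x ∈ (⊥ : Ideal S) :=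
    mem_of_algebraMap_mem_map (S' := S') (by rw [Ideal.map_bot, hx]; exact Ideal.zero_mem _)
  exact (Submodule.mem_bot S).mp this

/-- Divisibility is reflected: `φ x ∣ φ y ⇒ x ∣ y`. [cite: Matsumura1987, Thm. 7.5] -/
theorem dvd_of_map_dvd {x y : S} (h : algebraMap S S' x ∣ algebraMap S S' y) : x ∣ y := by
  rw [← Ideal.mem_span_singleton] at h ⊢
  refine mem_of_algebraMap_mem_map (S' := S') ?_
  rwa [Ideal.map_span, Set.image_singleton]

/-! ## §2. Ascent of the monomial type -/

/-- **Monomial type ascends**: `f = v g^ν` with `g ∈ 𝔪 ∖ 𝔪²` ⇒ `φ f = φ v · (φ g)^ν` with `φ g ∈ 𝔪' ∖ 𝔪'²`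
(reflection of `𝔪`-powers, p507256/p503771). [cite: Matsumura1987, §22 Cor. to Thm. 22.5] -/
theorem isMonomialType_map {f : S} (hf : IsMonomialType f) : IsMonomialType (algebraMap S S' f) := by
  obtain ⟨v, g, ν, hv, hg, hg2, rfl⟩ := hf
  refine ⟨algebraMap S S' v, algebraMap S S' g, ν, hv.map _, map_nonunit _ _ hg,
    fun h => hg2 ((mem_maximalIdeal_pow_iff_of_formallySmooth S S' 2 g).mpr h), by rw [map_mul, map_pow]⟩

/-! ## §3. Localisation: `S_q → S'_{P'}` reflects the powers of the maximal ideals -/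

omit [IsLocalHom (algebraMap S S')] in
/-- **The localised homomorphism reflects `𝔪`-powers**: for a prime `P'` of `S'` with contraction `q = P' ∩ S`, the
induced `S_q → S'_{P'}` is local, formally smooth and essentially of finite type (localisation of an essentially smooth
algebra, EGA IV 17.5.8), so `φ x ∈ P'^n ⊆ (P' S'_{P'})^n` forces `x ∈ (q S_q)^n = q^{(n)}`.
[cite: Grothendieck1967, Prop. 17.5.8] -/
theorem algebraMap_mem_pow_of_mem_pow (P' : Ideal S') [P'.IsPrime] {x : S} {n : ℕ}
    (hx : algebraMap S S' x ∈ P' ^ n) :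
    algebraMap S (Localization.AtPrime (P'.under S)) x ∈ maximalIdeal (Localization.AtPrime (P'.under S)) ^ n := by
  set q : Ideal S := P'.under S
  haveI : P'.LiesOver q := ⟨rfl⟩
  letI : Algebra (Localization.AtPrime q) (Localization.AtPrime P') := Localization.AtPrime.algebraOfLiesOver q P'
  set Sq := Localization.AtPrime q
  set SP := Localization.AtPrime P'
  haveI : IsLocalHom (algebraMap Sq SP) := by
    rw [Localization.AtPrime.IsLiesOverAlgebra.algebraMap_eq (p := q) (P := P')]
    infer_instance
  haveI : IsRegularLocalRing Sq := isRegularLocalRing_localization_atPrime S q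
  haveI : IsRegularLocalRing SP := isRegularLocalRing_localization_atPrime S' P'
  haveI : Algebra.FormallySmooth S' SP := Algebra.FormallySmooth.of_isLocalization P'.primeCompl
  haveI : Algebra.FormallySmooth S SP := Algebra.FormallySmooth.comp S S' SP
  haveI : Algebra.FormallySmooth Sq SP := Algebra.FormallySmooth.localization_base q.primeCompl
  haveI : Algebra.EssFiniteType S' SP := Algebra.EssFiniteType.of_isLocalization SP P'.primeCompl
  haveI : Algebra.EssFiniteType S SP := Algebra.EssFiniteType.comp S S' SP
  haveI : Algebra.EssFiniteType Sq SP := Algebra.EssFiniteType.of_comp S Sq SP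
  rw [mem_maximalIdeal_pow_iff_of_formallySmooth Sq SP n, ← IsScalarTower.algebraMap_apply,
    IsScalarTower.algebraMap_apply S S' SP, ← Localization.AtPrime.map_eq_maximalIdeal, ← Ideal.map_pow]
  exact Ideal.mem_map_of_mem _ hx

/-! ## §4. Descent of the monomial type in equal dimension two -/

omit [IsLocalHom (algebraMap S S')] in
/-- **A contracted height-one prime is generated by a regular parameter**: `S → S'` as above with `𝔪 S' = 𝔪'` and
`dim S = dim S' = 2`, `g' ∈ 𝔪' ∖ 𝔪'²`, and `p` a prime element of `S` with `φ p` associated to `g'^b`, `1 ≤ b` ⇒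
`b = 1`, i.e. `φ p` is associated to `g'` (so `p ∈ 𝔪 ∖ 𝔪²`).  [cite: Matsumura1987, Thm. 23.9] -/
theorem eq_one_of_associated_pow (h𝔪 : (maximalIdeal S).map (algebraMap S S') = maximalIdeal S')
    (hdim : ringKrullDim S = (2 : ℕ)) (hdim' : ringKrullDim S' = (2 : ℕ)) {g' : S'} (hg' : g' ∈ maximalIdeal S')
    (hg'2 : g' ∉ maximalIdeal S' ^ 2) {p : S} (hp : Prime p) {b : ℕ} (hb : 1 ≤ b)
    (hpb : Associated (algebraMap S S' p) (g' ^ b)) : b = 1 := by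
  classical
  haveI := isDomain_of_isRegularLocalRing S
  haveI := isDomain_of_isRegularLocalRing S'
  set φ := algebraMap S S' with hφ
  have hg'p : Prime g' := IsRegularLocalRing.prime_of_not_mem_sq hg' hg'2
  set P' : Ideal S' := Ideal.span {g'} with hP'
  haveI hP'p : P'.IsPrime := (Ideal.span_singleton_prime hg'p.ne_zero).mpr hg'p
  set q : Ideal S := P'.under S with hq
  have hpq : p ∈ q := by
    change φ p ∈ P'
    exact Ideal.mem_span_singleton.mpr ((dvd_pow_self g' (by omega : b ≠ 0)).trans hpb.symm.dvd)
  -- `q ≠ 𝔪`: otherwise `𝔪' = 𝔪 S' ⊆ (g')` would be principal, of height `≤ 1 < 2 = dim S'`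
  have hq𝔪 : q ≠ maximalIdeal S := by
    intro hq𝔪
    have hle : maximalIdeal S' ≤ P' := by
      rw [← h𝔪, Ideal.map_le_iff_le_comap]
      exact hq𝔪.symm.le
    have hP'𝔪 : P' = maximalIdeal S' := le_antisymm (IsLocalRing.le_maximalIdeal hP'p.ne_top) hle
    have h1 : (maximalIdeal S').height ≤ 1 := by
      rw [← hP'𝔪]
      exact Ideal.height_span_singleton_le_one hg'p.not_unit
    have h2 : ((maximalIdeal S').height : WithBot ℕ∞) = ((2 : ℕ) : WithBot ℕ∞) := by
      rw [IsLocalRing.maximalIdeal_height_eq_ringKrullDim, hdim']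
    rw [← WithBot.coe_natCast, WithBot.coe_inj] at h2
    have h2' : (maximalIdeal S').height = 2 := by exact_mod_cast h2
    rw [h2'] at h1
    exact absurd h1 (by norm_num)
  -- `q` has height one, hence `q = (p)`
  have h𝔪h : (maximalIdeal S).height = 2 := by
    have h := IsLocalRing.maximalIdeal_height_eq_ringKrullDim (R := S)
    rw [hdim, ← WithBot.coe_natCast, WithBot.coe_inj] at h
    exact_mod_cast h
  have hqlt : q < maximalIdeal S := lt_of_le_of_ne (IsLocalRing.le_maximalIdeal (Ideal.IsPrime.ne_top')) hq𝔪
  have hqh : q.height = 1 := by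
    have hlt := Ideal.height_strict_mono_of_isPrime_of_isPrime hqlt
    rw [h𝔪h] at hlt
    have hne : q.height ≠ 0 := by
      rw [Ne, Ideal.height_eq_zero_iff_eq_bot]
      intro hq0
      rw [hq0] at hpq
      exact hp.ne_zero ((Submodule.mem_bot S).mp hpq)
    have hlt2 : q.height < 2 := hlt
    generalize q.height = h at hne hlt2 ⊢
    induction h using ENat.recTopCoe with
    | top => exact absurd hlt2 (by simp)
    | coe h =>
      have h0 : h ≠ 0 := fun h0 => hne (by rw [h0]; rfl)
      have h2 : h < 2 := by exact_mod_cast hlt2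
      have h1 : h = 1 := by omega
      rw [h1]; rfl
  have hqp : q = Ideal.span {p} := Ideal.eq_span_singleton_of_height_eq_one hqh hpq hp
  -- if `b ≥ 2` then `φ p ∈ P'^2`, so `p ∈ (q S_q)^2 = (p^2) S_q`: impossible
  by_contra hb1
  have hb2 : 2 ≤ b := by omega
  have hφp2 : φ p ∈ P' ^ 2 := by
    refine Ideal.pow_le_pow_right hb2 ?_
    rw [hP', Ideal.span_singleton_pow]
    exact Ideal.mem_span_singleton.mpr hpb.symm.dvd
  have hmem := algebraMap_mem_pow_of_mem_pow P' hφp2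
  set Sq := Localization.AtPrime q
  haveI : IsRegularLocalRing Sq := isRegularLocalRing_localization_atPrime S q
  haveI := isDomain_of_isRegularLocalRing Sq
  have hmax : maximalIdeal Sq = Ideal.span {algebraMap S Sq p} := by
    rw [← Localization.AtPrime.map_eq_maximalIdeal, congrArg (Ideal.map (algebraMap S Sq)) hqp, Ideal.map_span,
      Set.image_singleton]
  have hmem' : algebraMap S Sq p ∈ maximalIdeal Sq ^ 2 := hmem
  rw [hmax, Ideal.span_singleton_pow, Ideal.mem_span_singleton'] at hmem'
  obtain ⟨c, hc⟩ := hmem'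
  have hp0 : algebraMap S Sq p ≠ 0 := fun h =>
    hp.ne_zero (IsLocalization.injective Sq (Ideal.primeCompl_le_nonZeroDivisors q) (by rw [h, map_zero]))
  have hunit : IsUnit (algebraMap S Sq p) := by
    refine isUnit_iff_exists_inv'.mpr ⟨c, ?_⟩
    have : (algebraMap S Sq p) * (c * algebraMap S Sq p) = (algebraMap S Sq p) * 1 := by
      rw [mul_one, mul_left_comm, ← pow_two, hc]
    exact mul_left_cancel₀ hp0 this
  have hpm : algebraMap S Sq p ∈ maximalIdeal Sq := by
    rw [hmax]; exact Ideal.mem_span_singleton_self _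
  exact (IsLocalRing.mem_maximalIdeal _).mp hpm hunit

/-- **Monomial type DESCENDS in equal dimension two**: `S → S'` local, formally smooth, essentially of finite type
between regular local rings of dimension two with `𝔪 S' = 𝔪'`; if `φ f = v' g'^ν` (`v'` a unit, `g' ∈ 𝔪' ∖ 𝔪'²`)
then `f = v p^ν` with `v` a unit and `p ∈ 𝔪 ∖ 𝔪²`.  [cite: Matsumura1987, Thm. 23.9 and Thm. 20.3] -/
theorem isMonomialType_of_map (h𝔪 : (maximalIdeal S).map (algebraMap S S') = maximalIdeal S')
    (hdim : ringKrullDim S = (2 : ℕ)) (hdim' : ringKrullDim S' = (2 : ℕ)) {f : S}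
    (hf : IsMonomialType (algebraMap S S' f)) : IsMonomialType f := by
  classical
  haveI := isDomain_of_isRegularLocalRing S
  haveI := isDomain_of_isRegularLocalRing S'
  haveI : UniqueFactorizationMonoid S := IsRegularLocalRing.uniqueFactorizationMonoid S
  set φ := algebraMap S S' with hφ
  obtain ⟨v', g', ν, hv', hg', hg'2, hfac⟩ := hf
  have hg'p : Prime g' := IsRegularLocalRing.prime_of_not_mem_sq hg' hg'2
  have h𝔪0 : maximalIdeal S ≠ ⊥ := by
    intro h
    rw [h, Ideal.map_bot] at h𝔪
    have : g' ∈ (⊥ : Ideal S') := h𝔪 ▸ hg'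
    exact hg'p.ne_zero ((Submodule.mem_bot S').mp this)
  rcases Nat.eq_zero_or_pos ν with hν | hν
  · -- `φ f` is a unit
    subst hν
    have hfu : IsUnit f := (isUnit_map_iff φ f).mp (by rw [hfac, pow_zero, mul_one]; exact hv')
    obtain ⟨g, hg, hg2⟩ := exists_mem_maximalIdeal_not_mem_sq h𝔪0
    exact ⟨f, g, 0, hfu, hg, hg2, by rw [pow_zero, mul_one]⟩
  · have hf0 : f ≠ 0 := by
      intro h
      rw [h, map_zero] at hfac
      exact (mul_ne_zero hv'.ne_zero (pow_ne_zero ν hg'p.ne_zero)) hfac.symm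
    set P' : Ideal S' := Ideal.span {g'} with hP'
    haveI hP'p : P'.IsPrime := (Ideal.span_singleton_prime hg'p.ne_zero).mpr hg'p
    set q : Ideal S := P'.under S with hq
    have hfq : f ∈ q := by
      change φ f ∈ P'
      rw [hfac]
      exact Ideal.mul_mem_left _ _ (Ideal.pow_mem_of_mem _ (Ideal.mem_span_singleton_self g') ν hν)
    -- a prime factor `p` of `f` inside `q`
    obtain ⟨p, hpf, hpq, hp⟩ : ∃ p, p ∣ f ∧ p ∈ q ∧ Prime p := by
      have hprod : (UniqueFactorizationMonoid.factors f).prod ∈ q := by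
        obtain ⟨u, hu⟩ := UniqueFactorizationMonoid.factors_prod hf0
        rw [← hu, Ideal.mul_unit_mem_iff_mem _ u.isUnit] at hfq
        exact hfq
      obtain ⟨p, hp₁, hp₂⟩ :=
        ((inferInstance : q.IsPrime).multiset_prod_mem_iff_exists_mem (UniqueFactorizationMonoid.factors f)).1 hprod
      exact ⟨p, UniqueFactorizationMonoid.dvd_of_mem_factors hp₁, hp₂,
        UniqueFactorizationMonoid.prime_of_factor p hp₁⟩
    -- `φ p` is associated to `g'^b`, `1 ≤ b ≤ ν`
    have hφp : φ p ∣ g' ^ ν := by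
      have h : φ p ∣ φ f := map_dvd φ hpf
      rw [hfac] at h
      exact hv'.dvd_mul_left.mp h
    obtain ⟨b, -, hpb⟩ := (dvd_prime_pow hg'p ν).mp hφp
    have hb1 : 1 ≤ b := by
      by_contra hb
      have hb0 : b = 0 := by omega
      rw [hb0, pow_zero] at hpb
      exact hp.not_unit ((isUnit_map_iff φ p).mp (associated_one_iff_isUnit.mp hpb))
    have hb : b = 1 := eq_one_of_associated_pow h𝔪 hdim hdim' hg' hg'2 hp hb1 hpb
    rw [hb, pow_one] at hpb
    -- `p` is a regular parameter of `S`
    have hpm : p ∈ maximalIdeal S := (IsLocalRing.mem_maximalIdeal _).mpr hp.not_unit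
    have hp2 : p ∉ maximalIdeal S ^ 2 := by
      intro h
      have h' := (mem_maximalIdeal_pow_iff_of_formallySmooth S S' 2 p).mp h
      obtain ⟨u, hu⟩ := hpb
      apply hg'2
      rw [← hu]
      exact Ideal.mul_mem_right _ _ h'
    -- `f` and `p^ν` divide each other after `φ`, hence before
    obtain ⟨u, hu⟩ := hpb
    have hφpν : φ (p ^ ν) * ↑(u ^ ν) = g' ^ ν := by rw [map_pow, Units.val_pow_eq_pow_val, ← mul_pow, hu]
    have hφpν' : φ (p ^ ν) = g' ^ ν * ↑(u ^ ν)⁻¹ := by rw [← hφpν, Units.mul_inv_cancel_right]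
    have h1 : p ^ ν ∣ f :=
      dvd_of_map_dvd (S' := S') ((Dvd.intro _ hφpν).trans (Dvd.intro_left v' hfac.symm))
    have h2' : φ f ∣ g' ^ ν :=
      Dvd.intro (↑hv'.unit⁻¹) (by rw [hfac, mul_assoc, mul_comm (g' ^ ν), ← mul_assoc, IsUnit.mul_val_inv, one_mul])
    have h2 : f ∣ p ^ ν := dvd_of_map_dvd (S' := S') (h2'.trans (Dvd.intro _ hφpν'.symm))
    obtain ⟨w, hw⟩ := associated_of_dvd_dvd h1 h2
    exact ⟨↑w, p, ν, Units.isUnit w, hpm, hp2, by rw [← hw, mul_comm]⟩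

end EssSmoothDescent

end Summit.ResolutionOfSingularities.ResolutionOfSingularities.Theorems

end
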